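import Mathlib
import Summits.Ventures.PercRepro2.CutVertexDefs

/-!
# Two-vertex separators `{x, a₁}`: the path lemmas
(blind cell PercRepro2, night-1 g33; proofs/NIGHT1-G33.md §8; the unified o-shield)

`IsSep2 ends x a₁ VA VB EA EB`: the vertex pair `{x, a₁}` separates `VA` from `VB`, the edges split
into `EA` (inside `VA ∪ {x, a₁}`) and `EB` (inside `VB ∪ {x, a₁}`).  The closure lemma
`mem_of_conn_of_closed` gives the path lemmas:
* `conn_cross`: a connection from `VA` to `VB` passes through `x` or `a₁`;
* `conn_x_a1_iff`: `x ↔ a₁` iff `x ↔_A a₁` or `x ↔_B a₁`;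
* **`conn_iff_restrict_of_not_conn`**: when `x ↮ a₁`, two vertices of `VA ∪ {x, a₁}` are connected iff
  they are connected by the `A`-edges alone (and symmetrically);
* `cluster_eq_union_of_not_conn`: when `x ↮ a₁`, `C(x) = C_A(x) ∪ C_B(x)`.
Standard axioms.
-/

namespace Summit.Ventures.PercRepro2.Sep2

open CutV

variable {V : Type*} {E : Type*}

/-- `{x, a₁}` separates `VA` from `VB`, with the edge partition `EA` / `EB`. -/
structure IsSep2 (ends : E → Sym2 V) (x a₁ : V) (VA VB : Set V) (EA EB : Set E) : Prop where
  /-- The two sides are disjoint. -/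
  disj : Disjoint VA VB
  /-- `x` is on neither side. -/
  x_notA : x ∉ VA
  /-- `x` is on neither side. -/
  x_notB : x ∉ VB
  /-- `a₁` is on neither side. -/
  a1_notA : a₁ ∉ VA
  /-- `a₁` is on neither side. -/
  a1_notB : a₁ ∉ VB
  /-- `A`-edges lie inside `VA ∪ {x, a₁}`. -/
  EA_sub : EA ⊆ within ends (VA ∪ {x, a₁})
  /-- `B`-edges lie inside `VB ∪ {x, a₁}`. -/
  EB_sub : EB ⊆ within ends (VB ∪ {x, a₁})
  /-- Every edge is on one of the two sides. -/
  cover : ∀ e, e ∈ EA ∨ e ∈ EB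
  /-- No edge is on both sides. -/
  Edisj : Disjoint EA EB

variable {ends : E → Sym2 V} {x a₁ : V} {VA VB : Set V} {EA EB : Set E}

/-- The separator read from the other side. -/
lemma IsSep2.symm (h : IsSep2 ends x a₁ VA VB EA EB) : IsSep2 ends x a₁ VB VA EB EA :=
  ⟨h.disj.symm, h.x_notB, h.x_notA, h.a1_notB, h.a1_notA, h.EB_sub, h.EA_sub,
    fun e => (h.cover e).symm, h.Edisj.symm⟩

/-- A vertex on both sides is `x` or `a₁`. -/
lemma IsSep2.eq_of_mem_both (h : IsSep2 ends x a₁ VA VB EA EB) {v : V} (hA : v ∈ VA ∪ {x, a₁})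
    (hB : v ∈ VB ∪ {x, a₁}) : v = x ∨ v = a₁ := by
  rcases hA with hA | hA
  · rcases hB with hB | hB
    · exact absurd hB (Set.disjoint_left.mp h.disj hA)
    · exact hB
  · exact hA

/-- Both endpoints of an `A`-edge lie on the `A`-side. -/
lemma IsSep2.ends_mem_of_mem_EA (h : IsSep2 ends x a₁ VA VB EA EB) {e : E} (he : e ∈ EA) {a b : V}
    (hab : ends e = s(a, b)) : a ∈ VA ∪ {x, a₁} ∧ b ∈ VA ∪ {x, a₁} := by
  obtain ⟨a', ha', b', hb', h'⟩ := h.EA_sub he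
  rw [hab] at h'
  rcases Sym2.eq_iff.mp h' with ⟨rfl, rfl⟩ | ⟨rfl, rfl⟩
  · exact ⟨ha', hb'⟩
  · exact ⟨hb', ha'⟩

section Paths

variable [DecidablePred (· ∈ EA)] [DecidablePred (· ∈ EB)]

/-- An open edge of the `A`-restriction is an open `A`-edge. -/
lemma openAdj_restrict_iff {ω : Config E} {a b : V} :
    OpenAdj ends (restrict EA ω) a b ↔ ∃ e ∈ EA, ω e = true ∧ ends e = s(a, b) := by
  constructor
  · rintro ⟨e, he, hends⟩
    by_cases hA : e ∈ EA
    · rw [restrict_apply_of_mem hA] at he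
      exact ⟨e, hA, he, hends⟩
    · rw [restrict_apply_of_notMem hA] at he
      exact absurd he Bool.false_ne_true
  · rintro ⟨e, hA, he, hends⟩
    refine ⟨e, ?_, hends⟩
    rw [restrict_apply_of_mem hA]
    exact he

omit [DecidablePred (· ∈ EB)] in
/-- An `A`-connection from the `A`-side stays on the `A`-side. -/
lemma mem_of_conn_restrict (h : IsSep2 ends x a₁ VA VB EA EB) {ω : Config E} {u v : V}
    (hu : u ∈ VA ∪ {x, a₁}) (huv : Conn ends (restrict EA ω) u v) : v ∈ VA ∪ {x, a₁} := by
  refine mem_of_conn_of_closed (S := VA ∪ {x, a₁}) ?_ hu huv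
  intro a ha b hab
  rw [openGraph_adj] at hab
  obtain ⟨_, e, he, hends⟩ := hab
  by_cases hA : e ∈ EA
  · exact (h.ends_mem_of_mem_EA hA hends).2
  · rw [restrict_apply_of_notMem hA] at he
    exact absurd he Bool.false_ne_true

omit [DecidablePred (· ∈ EA)] [DecidablePred (· ∈ EB)] in
/-- Vertices off `VA ∪ VB ∪ {x, a₁}` are isolated. -/
lemma mem_union_of_conn (h : IsSep2 ends x a₁ VA VB EA EB) {ω : Config E} {u v : V}
    (hu : u ∈ VA ∪ VB ∪ {x, a₁}) (huv : Conn ends ω u v) : v ∈ VA ∪ VB ∪ {x, a₁} := by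
  refine mem_of_conn_of_closed (S := VA ∪ VB ∪ {x, a₁}) ?_ hu huv
  intro a _ b hab
  rw [openGraph_adj] at hab
  obtain ⟨_, e, _, hends⟩ := hab
  rcases h.cover e with hA | hB
  · rcases (h.ends_mem_of_mem_EA hA hends).2 with hb | hb
    · exact Or.inl (Or.inl hb)
    · exact Or.inr hb
  · rcases (h.symm.ends_mem_of_mem_EA hB hends).2 with hb | hb
    · exact Or.inl (Or.inr hb)
    · exact Or.inr hb

/-- One open edge of `ω` extends an `A`-connection (if it is an `A`-edge) inside `A`. -/
lemma conn_restrict_of_openAdj {ω : Config E} {e : E} (hA : e ∈ EA) (he : ω e = true) {a b : V}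
    (hends : ends e = s(a, b)) : Conn ends (restrict EA ω) a b :=
  conn_of_openAdj ⟨e, by rw [restrict_apply_of_mem hA]; exact he, hends⟩

/-- **Path lemma under `x ↮ a₁`**: two vertices of `VA ∪ {x, a₁}` are connected iff they are
connected by the `A`-edges alone. -/
theorem conn_iff_restrict_of_not_conn (h : IsSep2 ends x a₁ VA VB EA EB) {ω : Config E}
    (hx1 : ¬ Conn ends ω x a₁) {u v : V} (hu : u ∈ VA ∪ {x, a₁}) (hv : v ∈ VA ∪ {x, a₁}) :
    Conn ends ω u v ↔ Conn ends (restrict EA ω) u v := by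
  refine ⟨fun huv => ?_, fun huv => conn_mono (restrict_le EA ω) huv⟩
  have hxA : ¬ Conn ends (restrict EA ω) x a₁ := fun hc => hx1 (conn_mono (restrict_le EA ω) hc)
  have hxB : ¬ Conn ends (restrict EB ω) x a₁ := fun hc => hx1 (conn_mono (restrict_le EB ω) hc)
  let S : Set V := {w | Conn ends (restrict EA ω) u w ∨
    (Conn ends (restrict EA ω) u x ∧ Conn ends (restrict EB ω) x w) ∨
    (Conn ends (restrict EA ω) u a₁ ∧ Conn ends (restrict EB ω) a₁ w)}
  have hS : ∀ a ∈ S, ∀ b, (openGraph ends ω).Adj a b → b ∈ S := by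
    intro a ha b hab
    rw [openGraph_adj] at hab
    obtain ⟨_, e, he, hends⟩ := hab
    rcases h.cover e with hA | hB
    · -- an `A`-edge: `a, b` on the `A`-side
      have hab' := conn_restrict_of_openAdj hA he hends
      rcases ha with h1 | ⟨h2, h2'⟩ | ⟨h3, h3'⟩
      · exact Or.inl (conn_trans h1 hab')
      · rcases h.eq_of_mem_both (h.ends_mem_of_mem_EA hA hends).1
          (mem_of_conn_restrict h.symm (Or.inr (Or.inl rfl)) h2') with rfl | rfl
        · exact Or.inl (conn_trans h2 hab')
        · exact absurd h2' hxB
      · rcases h.eq_of_mem_both (h.ends_mem_of_mem_EA hA hends).1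
          (mem_of_conn_restrict h.symm (Or.inr (Or.inr rfl)) h3') with rfl | rfl
        · exact absurd (conn_symm h3') hxB
        · exact Or.inl (conn_trans h3 hab')
    · -- a `B`-edge: `a, b` on the `B`-side
      have hab' := conn_restrict_of_openAdj hB he hends
      rcases ha with h1 | ⟨h2, h2'⟩ | ⟨h3, h3'⟩
      · rcases h.eq_of_mem_both (mem_of_conn_restrict h hu h1)
          (h.symm.ends_mem_of_mem_EA hB hends).1 with rfl | rfl
        · exact Or.inr (Or.inl ⟨h1, hab'⟩)
        · exact Or.inr (Or.inr ⟨h1, hab'⟩)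
      · exact Or.inr (Or.inl ⟨h2, conn_trans h2' hab'⟩)
      · exact Or.inr (Or.inr ⟨h3, conn_trans h3' hab'⟩)
  have hv' : v ∈ S := mem_of_conn_of_closed hS (Or.inl (conn_refl _ _ _)) huv
  rcases hv' with h1 | ⟨h2, h2'⟩ | ⟨h3, h3'⟩
  · exact h1
  · rcases h.eq_of_mem_both hv (mem_of_conn_restrict h.symm (Or.inr (Or.inl rfl)) h2') with
      rfl | rfl
    · exact h2
    · exact absurd h2' hxB
  · rcases h.eq_of_mem_both hv (mem_of_conn_restrict h.symm (Or.inr (Or.inr rfl)) h3') with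
      rfl | rfl
    · exact absurd (conn_symm h3') hxB
    · exact h3

/-- **`x ↔ a₁` iff `x ↔_A a₁` or `x ↔_B a₁`.** -/
theorem conn_x_a1_iff (h : IsSep2 ends x a₁ VA VB EA EB) {ω : Config E} :
    Conn ends ω x a₁ ↔
      Conn ends (restrict EA ω) x a₁ ∨ Conn ends (restrict EB ω) x a₁ := by
  constructor
  · intro hc
    by_contra hn
    have hn1 : ¬ Conn ends (restrict EA ω) x a₁ := fun hc => hn (Or.inl hc)
    have hn2 : ¬ Conn ends (restrict EB ω) x a₁ := fun hc => hn (Or.inr hc)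
    let S : Set V := {w | Conn ends (restrict EA ω) x w ∨ Conn ends (restrict EB ω) x w}
    have hS : ∀ a ∈ S, ∀ b, (openGraph ends ω).Adj a b → b ∈ S := by
      intro a ha b hab
      rw [openGraph_adj] at hab
      obtain ⟨_, e, he, hends⟩ := hab
      rcases h.cover e with hA | hB
      · have hab' := conn_restrict_of_openAdj hA he hends
        rcases ha with h1 | h2
        · exact Or.inl (conn_trans h1 hab')
        · rcases h.eq_of_mem_both (h.ends_mem_of_mem_EA hA hends).1
            (mem_of_conn_restrict h.symm (Or.inr (Or.inl rfl)) h2) with rfl | rfl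
          · exact Or.inl hab'
          · exact absurd h2 hn2
      · have hab' := conn_restrict_of_openAdj hB he hends
        rcases ha with h1 | h2
        · rcases h.eq_of_mem_both (mem_of_conn_restrict h (Or.inr (Or.inl rfl)) h1)
            (h.symm.ends_mem_of_mem_EA hB hends).1 with rfl | rfl
          · exact Or.inr hab'
          · exact absurd h1 hn1
        · exact Or.inr (conn_trans h2 hab')
    have := mem_of_conn_of_closed hS (Or.inl (conn_refl _ _ _)) hc
    exact hn this
  · rintro (hc | hc)
    · exact conn_mono (restrict_le EA ω) hc
    · exact conn_mono (restrict_le EB ω) hc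

omit [DecidablePred (· ∈ EB)] in
/-- **Crossing lemma**: a connection from `u ∈ VA` to `v ∈ VB` passes through `x` or `a₁`. -/
theorem conn_cross (h : IsSep2 ends x a₁ VA VB EA EB) {ω : Config E} {u v : V} (hu : u ∈ VA)
    (hv : v ∈ VB) (huv : Conn ends ω u v) : Conn ends ω u x ∨ Conn ends ω u a₁ := by
  by_contra hn
  have hn1 : ¬ Conn ends ω u x := fun hc => hn (Or.inl hc)
  have hn2 : ¬ Conn ends ω u a₁ := fun hc => hn (Or.inr hc)
  let S : Set V := {w | Conn ends (restrict EA ω) u w}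
  have hS : ∀ a ∈ S, ∀ b, (openGraph ends ω).Adj a b → b ∈ S := by
    intro a ha b hab
    rw [openGraph_adj] at hab
    obtain ⟨_, e, he, hends⟩ := hab
    rcases h.cover e with hA | hB
    · exact conn_trans ha (conn_restrict_of_openAdj hA he hends)
    · rcases h.eq_of_mem_both (mem_of_conn_restrict h (Or.inl hu) ha)
        (h.symm.ends_mem_of_mem_EA hB hends).1 with rfl | rfl
      · exact absurd (conn_mono (restrict_le EA ω) ha) hn1
      · exact absurd (conn_mono (restrict_le EA ω) ha) hn2
  have hv' : v ∈ S := mem_of_conn_of_closed hS (conn_refl _ _ _) huv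
  rcases mem_of_conn_restrict h (Or.inl hu) hv' with hvA | hvx
  · exact Set.disjoint_left.mp h.disj hvA hv
  · rcases hvx with rfl | rfl
    · exact h.x_notB hv
    · exact h.a1_notB hv

/-- **The cluster of `x` when `x ↮ a₁`**: `C(x) = C_A(x) ∪ C_B(x)`. -/
theorem cluster_eq_union_of_not_conn (h : IsSep2 ends x a₁ VA VB EA EB) {ω : Config E}
    (hx1 : ¬ Conn ends ω x a₁) :
    cluster ends ω x = cluster ends (restrict EA ω) x ∪ cluster ends (restrict EB ω) x := by
  ext v
  simp only [mem_cluster, Set.mem_union]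
  constructor
  · intro hv
    rcases mem_union_of_conn h (Or.inr (Or.inl rfl)) hv with (hvA | hvB) | hvx
    · exact Or.inl ((conn_iff_restrict_of_not_conn h hx1 (Or.inr (Or.inl rfl)) (Or.inl hvA)).1 hv)
    · exact Or.inr
        ((conn_iff_restrict_of_not_conn h.symm hx1 (Or.inr (Or.inl rfl)) (Or.inl hvB)).1 hv)
    · exact Or.inl ((conn_iff_restrict_of_not_conn h hx1 (Or.inr (Or.inl rfl)) (Or.inr hvx)).1 hv)
  · rintro (hv | hv)
    · exact conn_mono (restrict_le EA ω) hv
    · exact conn_mono (restrict_le EB ω) hv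

end Paths

end Summit.Ventures.PercRepro2.Sep2
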